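import Literature.Analysis.Complex.RiemannSphereDbar
import Literature.Analysis.Complex.DbarAlongCalculus
import Mathlib.Analysis.Complex.RemovableSingularity
import HarnessLib

/-!
# Transplanting functions between the two charts of the Riemann sphere

Topic `Literature/Analysis/Complex`. Chart calculus for the two-chart Riemann sphere
`S² = ℂ_z ∪ ℂ_w`, `w = z⁻¹`, of `Literature/Analysis/Complex/RiemannSphereHolderSections.lean`
(Hölder spaces `𝓗^{k,r}_τ(F)` of sections of the line bundle with clutching function `τ`, cutoff
`ρ`), used to build the Dolbeault right inverse of `∂̄` from Cauchy transforms in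
`Literature/Analysis/Complex/RiemannSphereDbarRightInverse.lean`:

* `dbarAlong_one_comp_inv` — the chain rule for the Cauchy–Riemann operator `∂̄ = dbarAlong 1`
  under the inversion, `∂̄ (f ∘ (·)⁻¹)(z) = -(z̄)⁻² (∂̄ f)(z⁻¹)` (from
  `RiemannSphere.dbarAlong_one_comp_of_hasDerivAt` of
  `Literature/Analysis/Complex/RiemannSphereDbar.lean`);
* `MemContDiffHolder.ofReal_smul` — real cutoffs times members of the Hölder classes
  `C^{k,r}_b(ℂ, F)`, written with the complex scalar action;
* `RiemannSphere.chiCut'` (`χ' w = 1 - χ w⁻¹`, the section `1 - χ` read in the `w`-chart, for the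
  inner cutoff `χ = RiemannSphere.chiCut` of `RiemannSphereDbar.lean`, `= 1` on `‖z‖ ≤ 1`, `= 0`
  on `‖z‖ ≥ 3/2`), with the partition identity `χ ρ + (1 - χ) (ρ ∘ (·)⁻¹) = 1`
  (`chiCut_mul_rhoCut_add`);
* `RiemannSphere.transplant c u` — the function `z ↦ c z • u z⁻¹` extended by `0` at `z = 0`: for
  `c` entire and `u` holomorphic for `‖z‖ > 2` with `u → 0` at infinity it is holomorphic on
  `‖z‖ < 1/2` (removable singularity, `differentiableOn_transplant`), its `∂̄` is computed by the
  chain rule (`dbarAlong_transplant_of_ne_zero`, `dbarAlong_transplant_zero`), and for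
  `u ∈ C^{m,r}_b` the piece `ρ • transplant c u` is in `C^{m,r}_b`
  (`memContDiffHolder_rhoCut_smul_transplant`).

Everything is proved; no named facts.

## References

* C. Wendl, *Holomorphic Curves in Low Dimensions*, LNM 2216 (2018), §2.1.3. [Wendl2018]
* L. Hörmander, *An Introduction to Complex Analysis in Several Variables*, 2nd ed. (1973),
  §1.1–§1.2. [HormanderSCV1973]
* D. Gilbarg, N. S. Trudinger, *Elliptic Partial Differential Equations of Second Order* (2001),
  §4.1. [GilbargTrudinger2001]
-/

noncomputable section

open Set Filter Metric Function
open scoped Topology NNReal ContDiff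

namespace Literature.Analysis.Complex

open _root_.Complex Literature.Analysis.FunctionSpaces

/-! ### `∂̄` under the inversion `z ↦ z⁻¹` -/

section ChainRule

variable {F : Type*} [NormedAddCommGroup F] [NormedSpace ℂ F]

/-- **`∂̄` under inversion**: `∂̄ (f ∘ (·)⁻¹) (z) = -(z̄)⁻² • (∂̄ f)(z⁻¹)` for `z ≠ 0` and `f`
real-differentiable at `z⁻¹`. [folklore] -/
theorem dbarAlong_one_comp_inv {f : ℂ → F} {z : ℂ} (hz : z ≠ 0)
    (hf : DifferentiableAt ℝ f z⁻¹) :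
    dbarAlong 1 (fun y => f y⁻¹) z = -((starRingEnd ℂ) z)⁻¹ ^ 2 • dbarAlong 1 f z⁻¹ := by
  rw [RiemannSphere.dbarAlong_one_comp_of_hasDerivAt (hasDerivAt_inv hz) hf, map_neg, map_inv₀,
    map_pow, inv_pow]

end ChainRule

/-! ### Real cutoffs on `C^{k,r}_b`, complex scalar action -/

section ComplexCoeff

variable {F : Type} [NormedAddCommGroup F] [NormedSpace ℂ F] {k : ℕ} {r : ℝ≥0}

/-- **A smooth compactly supported real cutoff times a member of `C^{k,r}_b(ℂ, F)` is a member**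
(written with the complex scalar action). [folklore] -/
theorem _root_.Literature.Analysis.FunctionSpaces.MemContDiffHolder.ofReal_smul
    (hr : r ≤ 1) {u : ℂ → F} (hu : MemContDiffHolder k r u) {χ : ℂ → ℝ} (hχ : ContDiff ℝ ∞ χ)
    (hχs : HasCompactSupport χ) : MemContDiffHolder k r fun z => (χ z : ℂ) • u z := by
  have h := (MemContDiffHolder.of_contDiff_of_hasCompactSupport hχ hχs hr).bilinear hr
    (ContinuousLinearMap.lsmul ℝ ℝ) hu
  simp only [ContinuousLinearMap.lsmul_apply] at h
  simpa only [Complex.coe_smul] using h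

end ComplexCoeff

namespace RiemannSphere

/-! ### The cutoff `χ` (in the `z`-chart) and its complement `χ'` (in the `w`-chart)

The inner cutoff `χ = chiCut` (`= 1` on `‖z‖ ≤ 1`, `= 0` on `‖z‖ ≥ 3/2`) is the one of
`Literature/Analysis/Complex/RiemannSphereDbar.lean`. -/

/-- `0 ≤ χ`. [folklore] -/
theorem chiCut_nonneg (z : ℂ) : 0 ≤ chiCut z := chiCutBump.nonneg

/-- `χ ≤ 1`. [folklore] -/
theorem chiCut_le_one (z : ℂ) : chiCut z ≤ 1 := chiCutBump.le_one

/-- `|χ| ≤ 1`. [folklore] -/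
theorem abs_chiCut_le_one (z : ℂ) : |chiCut z| ≤ 1 := by
  rw [abs_of_nonneg (chiCut_nonneg z)]
  exact chiCut_le_one z

/-- `χ = 0` off the open disc of radius `2`. [folklore] -/
theorem chiCut_eq_zero_of_two_le {z : ℂ} (hz : 2 ≤ ‖z‖) : chiCut z = 0 :=
  chiCut_eq_zero (le_trans (by norm_num) hz)

/-- Points where `χ ≠ 0` lie in the open disc of radius `2`. [folklore] -/
theorem norm_lt_two_of_chiCut_ne_zero {z : ℂ} (hz : chiCut z ≠ 0) : ‖z‖ < 2 := by
  by_contra h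
  exact hz (chiCut_eq_zero_of_two_le (not_lt.1 h))

/-- **The complementary cutoff `χ'` in the `w`-chart**: `χ' w = 1 - χ w⁻¹` for `w ≠ 0` and
`χ' 0 = 1`, i.e. the section `1 - χ` read in the chart `w = z⁻¹` (smooth: it is `≡ 1` on
`‖w‖ ≤ 1/2`; supported in `‖w‖ ≤ 1`). [folklore] -/
def chiCut' (w : ℂ) : ℝ := Function.update (fun w : ℂ => 1 - chiCut w⁻¹) 0 1 w

/-- `χ' w = 1 - χ w⁻¹` for `w ≠ 0`. [folklore] -/
theorem chiCut'_of_ne_zero {w : ℂ} (hw : w ≠ 0) : chiCut' w = 1 - chiCut w⁻¹ := by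
  simp [chiCut', hw]

/-- `χ' 0 = 1`. [folklore] -/
@[simp] theorem chiCut'_zero : chiCut' 0 = 1 := by
  simp [chiCut']

/-- `χ' = 1` on the closed disc of radius `1/2`. [folklore] -/
theorem chiCut'_eq_one {w : ℂ} (hw : ‖w‖ ≤ 2⁻¹) : chiCut' w = 1 := by
  by_cases h0 : w = 0
  · rw [h0, chiCut'_zero]
  · rw [chiCut'_of_ne_zero h0, chiCut_eq_zero_of_two_le, sub_zero]
    rw [norm_inv]
    have hpos : 0 < ‖w‖ := norm_pos_iff.2 h0
    calc (2 : ℝ) = (2⁻¹ : ℝ)⁻¹ := by norm_num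
      _ ≤ ‖w‖⁻¹ := inv_anti₀ hpos hw

/-- `χ' = 0` off the open unit disc. [folklore] -/
theorem chiCut'_eq_zero {w : ℂ} (hw : 1 ≤ ‖w‖) : chiCut' w = 0 := by
  have h0 : w ≠ 0 := by
    rintro rfl
    norm_num at hw
  rw [chiCut'_of_ne_zero h0, chiCut_eq_one, sub_self]
  rw [norm_inv]
  exact inv_le_one_of_one_le₀ hw

/-- `|χ'| ≤ 1`. [folklore] -/
theorem abs_chiCut'_le_one (w : ℂ) : |chiCut' w| ≤ 1 := by
  by_cases h0 : w = 0
  · rw [h0, chiCut'_zero, abs_one]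
  · rw [chiCut'_of_ne_zero h0, abs_le]
    constructor <;> linarith [chiCut_nonneg w⁻¹, chiCut_le_one w⁻¹]

/-- Points where `χ' ≠ 0` lie in the open unit disc. [folklore] -/
theorem norm_lt_one_of_chiCut'_ne_zero {w : ℂ} (hw : chiCut' w ≠ 0) : ‖w‖ < 1 := by
  by_contra h
  exact hw (chiCut'_eq_zero (not_lt.1 h))

/-- `χ'` is smooth: it is `1 - χ ∘ (·)⁻¹` near every `w ≠ 0` and `≡ 1` near `0`. [folklore] -/
theorem contDiff_chiCut' : ContDiff ℝ ∞ chiCut' := by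
  refine contDiff_iff_contDiffAt.2 fun w => ?_
  by_cases h0 : w = 0
  · subst h0
    have hev : chiCut' =ᶠ[𝓝 (0 : ℂ)] fun _ => (1 : ℝ) := by
      filter_upwards [Metric.ball_mem_nhds (0 : ℂ) (by norm_num : (0 : ℝ) < 2⁻¹)] with y hy
      rw [mem_ball, dist_zero_right] at hy
      exact chiCut'_eq_one hy.le
    exact (contDiffAt_const (c := (1 : ℝ))).congr_of_eventuallyEq hev
  · have hev : chiCut' =ᶠ[𝓝 w] fun y => 1 - chiCut y⁻¹ := by
      filter_upwards [isOpen_ne_zero.mem_nhds h0] with y hy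
      exact chiCut'_of_ne_zero hy
    refine ContDiffAt.congr_of_eventuallyEq ?_ hev
    have hinv : ContDiffAt ℝ ∞ (fun y : ℂ => y⁻¹) w :=
      (contDiffAt_inv ℂ h0).restrict_scalars ℝ
    exact contDiffAt_const.sub (contDiff_chiCut.contDiffAt.comp w hinv)

/-- `χ'` has compact support (inside the closed unit disc). [folklore] -/
theorem hasCompactSupport_chiCut' : HasCompactSupport chiCut' := by
  refine HasCompactSupport.intro (isCompact_closedBall (0 : ℂ) 1) fun w hw => ?_
  rw [mem_closedBall, dist_zero_right, not_le] at hw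
  exact chiCut'_eq_zero hw.le

/-- **The partition identity behind `∂̄ R = id`**: `χ z ρ z + (1 - χ z) ρ z⁻¹ = 1` for every `z`
(where `χ z ≠ 0` one has `‖z‖ < 2`, so `ρ z = 1`; where `χ z ≠ 1` one has `‖z‖ > 1`, so
`ρ z⁻¹ = 1`). [folklore] -/
theorem chiCut_mul_rhoCut_add (z : ℂ) :
    chiCut z * rhoCut z + (1 - chiCut z) * rhoCut z⁻¹ = 1 := by
  by_cases h1 : ‖z‖ ≤ 1
  · rw [chiCut_eq_one h1, rhoCut_eq_one (h1.trans (by norm_num))]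
    ring
  · have hz1 : 1 < ‖z‖ := not_le.1 h1
    have hρ' : rhoCut z⁻¹ = 1 := by
      refine rhoCut_eq_one ?_
      rw [norm_inv]
      exact (inv_le_one_of_one_le₀ hz1.le).trans (by norm_num)
    by_cases h2 : ‖z‖ < 2
    · rw [rhoCut_eq_one h2.le, hρ']
      ring
    · rw [chiCut_eq_zero_of_two_le (not_lt.1 h2), hρ']
      ring

/-! ### Transplanting a function to the other chart -/

section Transplant

variable {F : Type} [NormedAddCommGroup F] [NormedSpace ℂ F]

/-- **Transplant to the other chart**: `transplant c u z = c z • u z⁻¹` for `z ≠ 0`, and `0` at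
`z = 0` (the value forced by continuity when `u → 0` at infinity and `c` is continuous).
[folklore] -/
def transplant (c : ℂ → ℂ) (u : ℂ → F) : ℂ → F :=
  Function.update (fun z : ℂ => c z • u z⁻¹) 0 0

/-- `transplant c u z = c z • u z⁻¹` for `z ≠ 0`. [folklore] -/
theorem transplant_of_ne_zero (c : ℂ → ℂ) (u : ℂ → F) {z : ℂ} (hz : z ≠ 0) :
    transplant c u z = c z • u z⁻¹ := by
  simp [transplant, hz]

/-- `transplant c u 0 = 0`. [folklore] -/
@[simp] theorem transplant_zero (c : ℂ → ℂ) (u : ℂ → F) : transplant c u 0 = 0 := by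
  simp [transplant]

/-- Near `z ≠ 0`, `transplant c u` is the function `y ↦ c y • u y⁻¹`. [folklore] -/
theorem transplant_eventuallyEq (c : ℂ → ℂ) (u : ℂ → F) {z : ℂ} (hz : z ≠ 0) :
    transplant c u =ᶠ[𝓝 z] fun y => c y • u y⁻¹ := by
  filter_upwards [isOpen_ne_zero.mem_nhds hz] with y hy
  exact transplant_of_ne_zero c u hy

/-- `transplant c` is additive in `u`. [folklore] -/
theorem transplant_add (c : ℂ → ℂ) (u v : ℂ → F) :
    transplant c (u + v) = transplant c u + transplant c v := by
  funext z
  by_cases hz : z = 0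
  · simp [hz]
  · simp [transplant_of_ne_zero _ _ hz, smul_add]

/-- `transplant c` commutes with real scalars in `u`. [folklore] -/
theorem transplant_smul (c : ℂ → ℂ) (a : ℝ) (u : ℂ → F) :
    transplant c (a • u) = a • transplant c u := by
  funext z
  by_cases hz : z = 0
  · simp [hz]
  · simp [transplant_of_ne_zero _ _ hz, smul_comm (c z) a]

/-- **Continuity at the origin**: if `u → 0` at infinity and `c` is continuous at `0`, then
`transplant c u` is continuous at `0`. [folklore] -/
theorem continuousAt_transplant_zero {c : ℂ → ℂ} (hc : ContinuousAt c 0) {u : ℂ → F}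
    (hu : Tendsto u (cocompact ℂ) (𝓝 0)) : ContinuousAt (transplant c u) 0 := by
  rw [transplant, continuousAt_update_same]
  have h1 : Tendsto (fun z : ℂ => u z⁻¹) (𝓝[≠] (0 : ℂ)) (𝓝 0) := by
    have hi : Tendsto (fun z : ℂ => z⁻¹) (𝓝[≠] (0 : ℂ)) (cocompact ℂ) := by
      rw [← Metric.cobounded_eq_cocompact]
      exact tendsto_inv₀_nhdsNE_zero
    exact hu.comp hi
  have h2 : Tendsto c (𝓝[≠] (0 : ℂ)) (𝓝 (c 0)) := tendsto_nhdsWithin_of_tendsto_nhds hc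
  simpa using h2.smul h1

/-- **Holomorphy of the transplant near the origin (removable singularity).** If `c` is entire,
`u` is complex-differentiable at every `z` with `‖z‖ > 2` and `u → 0` at infinity, then
`transplant c u` is holomorphic on the disc `‖z‖ < 1/2`. [folklore] -/
theorem differentiableOn_transplant {c : ℂ → ℂ} (hc : Differentiable ℂ c) {u : ℂ → F}
    [CompleteSpace F] (hhol : ∀ z : ℂ, 2 < ‖z‖ → DifferentiableAt ℂ u z)
    (hu : Tendsto u (cocompact ℂ) (𝓝 0)) :
    DifferentiableOn ℂ (transplant c u) (ball (0 : ℂ) 2⁻¹) := by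
  rw [← Complex.differentiableOn_compl_singleton_and_continuousAt_iff
    (Metric.ball_mem_nhds (0 : ℂ) (by norm_num))]
  refine ⟨fun z hz => ?_, continuousAt_transplant_zero hc.continuous.continuousAt hu⟩
  obtain ⟨hzb, hz0⟩ := hz
  rw [mem_ball, dist_zero_right] at hzb
  have hz0 : z ≠ 0 := hz0
  have hzi : 2 < ‖z⁻¹‖ := by
    rw [norm_inv]
    have := inv_strictAnti₀ (norm_pos_iff.2 hz0) hzb
    simpa using this
  have hd : DifferentiableAt ℂ (fun y => c y • u y⁻¹) z :=
    (hc z).smul ((hhol _ hzi).comp z (differentiableAt_inv (𝕜 := ℂ) hz0))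
  exact (hd.congr_of_eventuallyEq (transplant_eventuallyEq c u hz0)).differentiableWithinAt

/-- The transplant is complex-differentiable at the origin. [folklore] -/
theorem differentiableAt_transplant_zero {c : ℂ → ℂ} (hc : Differentiable ℂ c) {u : ℂ → F}
    [CompleteSpace F] (hhol : ∀ z : ℂ, 2 < ‖z‖ → DifferentiableAt ℂ u z)
    (hu : Tendsto u (cocompact ℂ) (𝓝 0)) : DifferentiableAt ℂ (transplant c u) 0 :=
  (differentiableOn_transplant hc hhol hu).differentiableAt
    (Metric.ball_mem_nhds (0 : ℂ) (by norm_num))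

/-- **`∂̄` of the transplant vanishes at the origin.** [folklore] -/
theorem dbarAlong_transplant_zero {c : ℂ → ℂ} (hc : Differentiable ℂ c) {u : ℂ → F}
    [CompleteSpace F] (hhol : ∀ z : ℂ, 2 < ‖z‖ → DifferentiableAt ℂ u z)
    (hu : Tendsto u (cocompact ℂ) (𝓝 0)) : dbarAlong 1 (transplant c u) 0 = 0 :=
  dbarAlong_eq_zero_of_differentiableAt (differentiableAt_transplant_zero hc hhol hu) 1

/-- The transplant is real-smooth on the disc `‖z‖ < 1/2` (it is holomorphic there). [folklore] -/
theorem contDiffOn_transplant {c : ℂ → ℂ} (hc : Differentiable ℂ c) {u : ℂ → F}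
    [CompleteSpace F] (hhol : ∀ z : ℂ, 2 < ‖z‖ → DifferentiableAt ℂ u z)
    (hu : Tendsto u (cocompact ℂ) (𝓝 0)) :
    ContDiffOn ℝ ∞ (transplant c u) (ball (0 : ℂ) 2⁻¹) :=
  (((differentiableOn_transplant hc hhol hu).contDiffOn isOpen_ball :
    ContDiffOn ℂ ∞ (transplant c u) (ball (0 : ℂ) 2⁻¹))).restrict_scalars ℝ

/-- **`∂̄` of the transplant off the origin** (chain rule under inversion, `c` holomorphic):
`∂̄ (transplant c u) (z) = -(c z (z̄)⁻²) • (∂̄ u)(z⁻¹)`. [folklore] -/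
theorem dbarAlong_transplant_of_ne_zero {c : ℂ → ℂ} (hc : Differentiable ℂ c) {u : ℂ → F}
    (hud : Differentiable ℝ u) {z : ℂ} (hz : z ≠ 0) :
    dbarAlong 1 (transplant c u) z =
      -(c z * ((starRingEnd ℂ) z)⁻¹ ^ 2) • dbarAlong 1 u z⁻¹ := by
  rw [dbarAlong_congr_of_eventuallyEq (transplant_eventuallyEq c u hz)]
  have hinv : DifferentiableAt ℝ (fun y : ℂ => u y⁻¹) z :=
    (hud _).comp z (differentiableAt_inv (𝕜 := ℝ) hz)
  rw [dbarAlong_smul ((hc z).restrictScalars ℝ) hinv,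
    dbarAlong_eq_zero_of_differentiableAt (hc z) 1, zero_smul, zero_add,
    dbarAlong_one_comp_inv hz (hud _), smul_smul, mul_neg]

/-- The transplant of a real-differentiable `u` (holomorphic for `‖z‖ > 2`, `→ 0` at infinity,
`c` entire) is real-differentiable everywhere. [folklore] -/
theorem differentiable_transplant {c : ℂ → ℂ} (hc : Differentiable ℂ c) {u : ℂ → F}
    [CompleteSpace F] (hud : Differentiable ℝ u) (hhol : ∀ z : ℂ, 2 < ‖z‖ → DifferentiableAt ℂ u z)
    (hu : Tendsto u (cocompact ℂ) (𝓝 0)) : Differentiable ℝ (transplant c u) := by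
  intro z
  by_cases hz : z = 0
  · subst hz
    exact (differentiableAt_transplant_zero hc hhol hu).restrictScalars ℝ
  · have hd : DifferentiableAt ℝ (fun y => c y • u y⁻¹) z :=
      ((hc z).restrictScalars ℝ).smul ((hud _).comp z (differentiableAt_inv (𝕜 := ℝ) hz))
    exact hd.congr_of_eventuallyEq (transplant_eventuallyEq c u hz)

/-- **The transplant of a member of `C^{m,r}_b` is a member near the sphere's disc**: for
`u ∈ C^{m,r}_b(ℂ, F)` holomorphic for `‖z‖ > 2` and tending to `0` at infinity, and `c` entire,
`ρ • transplant c u ∈ C^{m,r}_b` (`r ≤ 1`). Split `ρ = ψ + (ρ - ψ)` with a cutoff `ψ ≡ 1` near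
`0` supported in `‖z‖ < 1/2`: `ψ • transplant c u` is smooth with compact support (holomorphy on
the small disc), and `(ρ - ψ) • transplant c u = c • ((ρ - ψ) • u ∘ (·)⁻¹)` is a localized
pre-composition with the inversion, smooth on `z ≠ 0`. [folklore] -/
theorem memContDiffHolder_rhoCut_smul_transplant [CompleteSpace F] {m : ℕ} {r : ℝ≥0}
    (hr : r ≤ 1) {c : ℂ → ℂ} (hc : Differentiable ℂ c) (hcs : ContDiff ℝ ∞ c) {u : ℂ → F}
    (hum : MemContDiffHolder m r u) (hhol : ∀ z : ℂ, 2 < ‖z‖ → DifferentiableAt ℂ u z)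
    (hu : Tendsto u (cocompact ℂ) (𝓝 0)) :
    MemContDiffHolder m r fun z => (rhoCut z : ℂ) • transplant c u z := by
  -- the small cutoff `ψ`
  let ψb : ContDiffBump (0 : ℂ) := ⟨4⁻¹, 3⁻¹, by norm_num, by norm_num⟩
  have hψ1 : ∀ z : ℂ, ‖z‖ ≤ 4⁻¹ → ψb z = 1 := fun z hz =>
    ψb.one_of_mem_closedBall (by simpa [ψb] using hz)
  have hψt : tsupport ψb ⊆ ball (0 : ℂ) 2⁻¹ := by
    rw [ψb.tsupport_eq]
    exact closedBall_subset_ball (by norm_num [ψb])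
  -- piece 1: `ψ • transplant c u`, smooth with compact support
  have h1 : MemContDiffHolder m r fun z => ψb z • transplant c u z :=
    MemContDiffHolder.of_contDiff_of_hasCompactSupport
      (ContDiff.smul_of_contDiffOn ψb.contDiff isOpen_ball (contDiffOn_transplant hc hhol hu) hψt)
      ψb.hasCompactSupport.smul_right hr
  -- piece 2: `(ρ - ψ) • u ∘ inv`, a localized pre-composition
  set θ : ℂ → ℝ := fun z => rhoCut z - ψb z with hθ
  have hθs : ContDiff ℝ ∞ θ := contDiff_rhoCut.sub ψb.contDiff
  have hθc : HasCompactSupport θ := hasCompactSupport_rhoCut.sub ψb.hasCompactSupport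
  have hθ0 : ∀ z : ℂ, ‖z‖ < 4⁻¹ → θ z = 0 := fun z hz => by
    simp only [hθ, hψ1 z hz.le, rhoCut_eq_one (hz.le.trans (by norm_num)), sub_self]
  have hθt : tsupport θ ⊆ {z : ℂ | z ≠ 0} := by
    have hsub : Function.support θ ⊆ (ball (0 : ℂ) 4⁻¹)ᶜ := fun z hz hzb => by
      rw [mem_ball, dist_zero_right] at hzb
      exact hz (hθ0 z hzb)
    refine (closure_minimal hsub isOpen_ball.isClosed_compl).trans fun z hz h0 => hz ?_
    have h0 : z = 0 := by simpa using h0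
    simp [h0]
  have h2 : MemContDiffHolder m r fun z => θ z • u z⁻¹ :=
    hum.smul_comp_of_contDiffOn hr isOpen_ne_zero contDiffOn_inv hθs hθc hθt
  have h2s : HasCompactSupport fun z => θ z • u z⁻¹ := hθc.smul_right
  have h3 : MemContDiffHolder m r fun z => c z • (θ z • u z⁻¹) :=
    memContDiffHolder_smul_of_contDiffOn hr h2 h2s isOpen_univ hcs.contDiffOn (subset_univ _)
  -- the sum is the function in question
  have heq : (fun z => (rhoCut z : ℂ) • transplant c u z) =
      (fun z => ψb z • transplant c u z) + fun z => c z • (θ z • u z⁻¹) := by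
    funext z
    simp only [Pi.add_apply]
    by_cases hz : z = 0
    · have : θ 0 = 0 := hθ0 0 (by norm_num)
      simp [hz, this]
    · rw [transplant_of_ne_zero c u hz]
      simp only [hθ, ← Complex.coe_smul, smul_smul, Complex.ofReal_sub]
      rw [← add_smul]
      congr 1
      ring
  rw [heq]
  exact h1.add h3

end Transplant

end RiemannSphere

end Literature.Analysis.Complex

end
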